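import Summits.QuantumFields.BalabanUV.T4Continuum.Support.NE3ClassRadiusFamily
import HarnessLib

/-!
# NE7ClassPoincareLinesGeneric — THE FOUR k-FREE NUMERIC LINES OF (P♮)_W EXIST FOR EVERY GAUGE RANK `card n`, EVERY BLOCK SIZE `L` AND EVERY DIMENSION `d`; hence the class
# slice-Poincaré inequality (P♮)_W on the small-field class `sfClass d L N ε (j+1)` for EVERY unitary gauge group `U(n)`, every `L ≥ 2`, every `d ≥ 3`, with ONE constant and ONE
# class radius depending on `(d, L, card n)` only — the SU(2)∕SU(3), `L = 2` numerics (`lines_d4_L2_c2∕c3`, `norm_num`) replaced by a soft existence proof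

Cell `pub-balaban`, rung (B)+1 sub-cell t4, lineage `b2b-balaban-t4-ne7-p1`, generation 109 (CRUX PROVER NE7 #1 = OWNER of BINDER row NE7).  Memo
`t4/b2b-balaban-t4-ne7-p1-g109/ROAD-G109.md` §1.
WHY.  Every file of the NE3∕NE7 chain down to route 1's docked END (`NE7Route1EndDockedSmallDataSU2Reg`, p803830) is stated at `card n = 2`, `L = 2` for ONE reason: the four k-free
numeric lines of row NE3-R2's `NE3ClassSlicePoincare.classSlicePoincare_of_lines` (`ShLine ≤ 1∕2`, `SmallYLine ≤ 1∕2`, the ℓ²-defect line, K6-Ξ) were closed by `norm_num` at the point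
`(d, L, card n, εc, θ) = (4, 2, 2, 10⁻¹⁷, 10⁻⁵³)` (and `card n = 3`).  The T⁴ family of record has `L` odd `> 11` (`T4Continuum.T4Family.hL11`) and the summit statement ranges over every
compact gauge group, so an `L = 2`, SU(2)-only chain cannot be instantiated at the carriers of record.  THIS FILE removes the numerics: for every `d ≥ 1`, `L ≥ 1`, `c ≥ 0` there are
`εc > 0` and `0 < θ ≤ 1` closing all four lines together with the two class-radius lines of `NE3ClassRadiusFamily.levelSmall_family` (§3), by CONTINUITY: at `θ = 0` every line
polynomial collapses (`ShLine = 1∕4`, `SmallYLine = 2(1 + 2(1+8εc)·b_h(0))(24εc + (18¼)εc²) + 9εc`, the other lines `= 0`), so one first takes `εc` small (the `θ = 0` value of `SmallYLine`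
is a polynomial in `εc` vanishing at `0`) and then `θ` small (each line is continuous in `θ` at fixed `εc ≠ 0`).
WHAT ([folklore]; 0 def, 0 sorry).  §1 continuity in `θ` of every line polynomial of `NE3SlicePoincareBudgetLine`; §2 their values at `θ = 0`; §3 **`lines_exist`**; §4
**`classSlicePoincare_generic`**: `3 ≤ d`, `2 ≤ L`, ANY `n` ⟹ `∃ εc θ` (with the K6-Ξ line, the two radius lines and `0 ≤ CPLine` exported for the consumers) such that for every `N ≥ 1`,
every class radius `0 < ε ≤ θ`, every level `j+1` and every `W ∈ sfClass d L N ε (j+1)`: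
`SlicePoincare L (j+1) W (frameFreeBlockLandauW L N (j+1) W) (CPLine d L (card n) εc θ) (periodBox (N·L^{j+1}))` — row NE3-R2's `classSlicePoincare_of_lines'` BY NAME.
HONEST FRAMING (page 1): elementary real analysis (continuity at one point) on OUR line polynomials + row NE3-R2's K-g11∕K-g12 theorems by name; the constants `εc, θ, CPLine` are
EXISTENTIAL (no decimal value is claimed for general `(d, L, card n)`; at `(4, 2, 2)` the record's `10⁻¹⁷, 10⁻⁵³, 1234·10¹⁴` remain the explicit instance); (P♮)_W itself is leaf-02's
K6c-2b; nothing of Bałaban's asserted; NE3∕NE7 NOT proved as spine nodes; spine 0∕9; finite T⁴ rung (B)+1 — NOT infinite volume, NOT mass gap, NOT BetaPertH, NOT Clay (continuum YM on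
T⁴ ⇐ BetaPertH ∧ nine spine estimates).
-/

set_option autoImplicit false

open scoped Topology
open Filter

namespace Summit.QuantumFields.BalabanUV.T4Continuum.NE7ClassPoincareLinesGeneric

open Literature.MathematicalPhysics.QuantumFieldTheory.Balaban1983to89
open B7Prop1Explicit B7Prop2Explicit
open T4AveragingDeficitWallBoundary (periodBox)
open AveragingDeficitTwoLevelPrep (twoLevelSmall)
open NE3CovariantLineSumsL2 (C2sq)
open NE3CovariantLineSumsL2Tower (rho)
open MinimalActionRate (sfClass)
open NE3SlicePoincareShape (SlicePoincare)
open NE3FrameFreeSliceW (frameFreeBlockLandauW)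
open NE3SlicePoincareBudgetLine
open NE3ClassRadiusFamily (classSlicePoincare_of_lines' CPLine_nonneg)

noncomputable section

/-! ## §1 Continuity of the line polynomials in the one letter `θ` -/

section Continuity

variable (d L : ℕ) (c ε : ℝ)

/-- `θ ↦ lrTop d θ` is continuous. [folklore] -/
theorem continuous_lrTop : Continuous fun θ : ℝ => lrTop d θ := by
  unfold lrTop; fun_prop

/-- `θ ↦ cjTop d θ` is continuous. [folklore] -/
theorem continuous_cjTop : Continuous fun θ : ℝ => cjTop d θ := by
  have h := continuous_lrTop d
  unfold cjTop; fun_prop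

/-- `θ ↦ cfTop d θ` is continuous. [folklore] -/
theorem continuous_cfTop : Continuous fun θ : ℝ => cfTop d θ := by
  have h := continuous_lrTop d
  unfold cfTop; fun_prop

/-- `θ ↦ wTop d θ` is continuous. [folklore] -/
theorem continuous_wTop : Continuous fun θ : ℝ => wTop d θ := by
  unfold wTop; fun_prop

/-- `θ ↦ qTop d θ` is continuous. [folklore] -/
theorem continuous_qTop : Continuous fun θ : ℝ => qTop d θ := by
  have h := continuous_lrTop d
  unfold qTop; fun_prop

/-- `θ ↦ sTop d L θ` is continuous. [folklore] -/
theorem continuous_sTop : Continuous fun θ : ℝ => sTop d L θ := by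
  unfold sTop; fun_prop

/-- `θ ↦ ALine d c ε θ` is continuous. [folklore] -/
theorem continuous_ALine : Continuous fun θ : ℝ => ALine d c ε θ := by
  have h := continuous_cfTop d
  unfold ALine; fun_prop

/-- `θ ↦ ShLine d L c ε θ` is continuous. [folklore] -/
theorem continuous_ShLine : Continuous fun θ : ℝ => ShLine d L c ε θ := by
  have h1 := continuous_qTop d
  have h2 := continuous_cfTop d
  have h3 := continuous_ALine d c ε
  unfold ShLine; fun_prop

/-- `θ ↦ gTop d c θ` is continuous. [folklore] -/
theorem continuous_gTop : Continuous fun θ : ℝ => gTop d c θ := by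
  have h1 := continuous_wTop d
  have h2 := continuous_cjTop d
  unfold gTop; fun_prop

/-- `θ ↦ bhTop d L c θ` is continuous. [folklore] -/
theorem continuous_bhTop : Continuous fun θ : ℝ => bhTop d L c θ := by
  have h1 := continuous_wTop d
  have h2 := continuous_qTop d
  unfold bhTop; fun_prop

/-- `θ ↦ KhLine d L c ε θ` is continuous. [folklore] -/
theorem continuous_KhLine : Continuous fun θ : ℝ => KhLine d L c ε θ := by
  have h1 := continuous_gTop d c
  have h2 := continuous_bhTop d L c
  unfold KhLine; fun_prop

/-- `θ ↦ kTop d c θ` is continuous. [folklore] -/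
theorem continuous_kTop : Continuous fun θ : ℝ => kTop d c θ := by
  have h := continuous_cjTop d
  unfold kTop; fun_prop

/-- `θ ↦ SyLine d L c ε θ` is continuous. [folklore] -/
theorem continuous_SyLine : Continuous fun θ : ℝ => SyLine d L c ε θ := by
  have h1 := continuous_sTop d L
  have h2 := continuous_lrTop d
  have h3 := continuous_kTop d c
  have h4 := continuous_cfTop d
  have h5 := continuous_ALine d c ε
  unfold SyLine; fun_prop

/-- `θ ↦ dkTop d θ` is continuous. [folklore] -/
theorem continuous_dkTop : Continuous fun θ : ℝ => dkTop d θ := by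
  have h := continuous_lrTop d
  unfold dkTop; fun_prop

/-- `θ ↦ pkTop d θ` is continuous. [folklore] -/
theorem continuous_pkTop : Continuous fun θ : ℝ => pkTop d θ := by
  have h := continuous_lrTop d
  unfold pkTop; fun_prop

/-- `θ ↦ byTop d L c ε θ` is continuous. [folklore] -/
theorem continuous_byTop : Continuous fun θ : ℝ => byTop d L c ε θ := by
  have h1 := continuous_wTop d
  have h2 := continuous_sTop d L
  have h3 := continuous_lrTop d
  have h4 := continuous_dkTop d
  have h5 := continuous_pkTop d
  unfold byTop; fun_prop

/-- `θ ↦ gzTop d c ε θ` is continuous. [folklore] -/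
theorem continuous_gzTop : Continuous fun θ : ℝ => gzTop d c ε θ := by
  have h1 := continuous_wTop d
  have h2 := continuous_cjTop d
  unfold gzTop; fun_prop

/-- `θ ↦ sTwoLine d L c ε θ` is continuous. [folklore] -/
theorem continuous_sTwoLine : Continuous fun θ : ℝ => sTwoLine d L c ε θ := by
  have h1 := continuous_gTop d c
  have h2 := continuous_byTop d L c ε
  have h3 := continuous_gzTop d c ε
  unfold sTwoLine; fun_prop

/-- `θ ↦ SmallYLine d L c ε θ` is continuous. [folklore] -/
theorem continuous_SmallYLine : Continuous fun θ : ℝ => SmallYLine d L c ε θ := by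
  have h1 := continuous_KhLine d L c ε
  have h2 := continuous_SyLine d L c ε
  have h3 := continuous_sTwoLine d L c ε
  unfold SmallYLine; fun_prop

end Continuity

/-! ## §2 The values of the line polynomials at `θ = 0` -/

section AtZero

variable (d L : ℕ) (c ε : ℝ)

/-- `lrTop d 0 = 0`. [folklore] -/
theorem lrTop_zero : lrTop d 0 = 0 := by simp [lrTop]

/-- `cjTop d 0 = 0`. [folklore] -/
theorem cjTop_zero : cjTop d 0 = 0 := by simp [cjTop, lrTop_zero]

/-- `cfTop d 0 = 0`. [folklore] -/
theorem cfTop_zero : cfTop d 0 = 0 := by simp [cfTop, lrTop_zero]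

/-- `wTop d 0 = 1`. [folklore] -/
theorem wTop_zero : wTop d 0 = 1 := by simp [wTop]

/-- `qTop d 0 = 0`. [folklore] -/
theorem qTop_zero : qTop d 0 = 0 := by simp [qTop, lrTop_zero]

/-- `sTop d L 0 = 0`. [folklore] -/
theorem sTop_zero : sTop d L 0 = 0 := by simp [sTop]

/-- `ALine d c ε 0 = 18 + 1∕4`. [folklore] -/
theorem ALine_zero : ALine d c ε 0 = 18 + 1 / 4 := by simp [ALine, cfTop_zero]

/-- **`ShLine d L c ε 0 = 1∕4`.** [folklore] -/
theorem ShLine_zero : ShLine d L c ε 0 = 1 / 4 := by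
  simp [ShLine, qTop_zero, cfTop_zero, ALine_zero]

/-- `gTop d c 0 = 0`. [folklore] -/
theorem gTop_zero : gTop d c 0 = 0 := by simp [gTop, cjTop_zero]

/-- `kTop d c 0 = 0`. [folklore] -/
theorem kTop_zero : kTop d c 0 = 0 := by simp [kTop, cjTop_zero]

/-- `SyLine d L c ε 0 = 24ε + (18 + 1∕4)ε²`. [folklore] -/
theorem SyLine_zero : SyLine d L c ε 0 = 24 * ε + (18 + 1 / 4) * ε ^ 2 := by
  simp [SyLine, sTop_zero, lrTop_zero, kTop_zero, cfTop_zero, ALine_zero]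

/-- `dkTop d 0 = 0`. [folklore] -/
theorem dkTop_zero : dkTop d 0 = 0 := by simp [dkTop, lrTop_zero]

/-- `pkTop d 0 = 0`. [folklore] -/
theorem pkTop_zero : pkTop d 0 = 0 := by simp [pkTop, lrTop_zero]

/-- `byTop d L c ε 0 = 0`. [folklore] -/
theorem byTop_zero : byTop d L c ε 0 = 0 := by
  simp [byTop, sTop_zero, lrTop_zero, dkTop_zero, pkTop_zero]

/-- `gzTop d c ε 0 = 0`. [folklore] -/
theorem gzTop_zero : gzTop d c ε 0 = 0 := by simp [gzTop, cjTop_zero]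

/-- `sTwoLine d L c ε 0 = 9ε`. [folklore] -/
theorem sTwoLine_zero : sTwoLine d L c ε 0 = 9 * ε := by
  simp [sTwoLine, gTop_zero, byTop_zero, gzTop_zero]

/-- `KhLine d L c ε 0 = 1 + (1 + 8ε)·2·bhTop d L c 0`. [folklore] -/
theorem KhLine_zero : KhLine d L c ε 0 = 1 + (1 + 8 * ε) * 2 * bhTop d L c 0 := by
  simp [KhLine, gTop_zero]

/-- **`SmallYLine d L c ε 0 = 2(1 + (1+8ε)·2·b_h(0))·(24ε + (18¼)ε²) + 9ε`** — a polynomial in `ε` vanishing at `ε = 0` (`b_h(0) = bhTop d L c 0` does not depend on `ε`).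
[folklore] -/
theorem SmallYLine_zero :
    SmallYLine d L c ε 0 = 2 * (1 + (1 + 8 * ε) * 2 * bhTop d L c 0) * (24 * ε + (18 + 1 / 4) * ε ^ 2) + 9 * ε := by
  simp [SmallYLine, KhLine_zero, SyLine_zero, sTwoLine_zero]

end AtZero

/-! ## §3 The four lines (and the two class-radius lines) hold at SOME `(εc, θ)` — every `d ≥ 1`, `L ≥ 1`, `c ≥ 0` -/

/-- `0 < rho d L` for `L ≥ 1`. [folklore] -/
theorem rho_pos (d : ℕ) {L : ℕ} (hL : 1 ≤ L) : 0 < rho d L := by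
  unfold rho
  have hL0 : (0 : ℝ) < L := by exact_mod_cast hL
  exact Real.sqrt_pos.2 (by positivity)

/-- **THE LINES EXIST.**  For every `d ≥ 1`, `L ≥ 1` and `c ≥ 0` there are `εc > 0` and `0 < θ ≤ 1` with
`ShLine d L c εc θ ≤ 1∕2`, `SmallYLine d L c εc θ ≤ 1∕2`, `(68∕3)(d+1)(d+4)·C2sq d L·θ ≤ rho d L∕2`, `8d((d−1)θ)² + 2c((4d²+272d(d+1)(d+4))θ)² ≤ 1∕2` (K6-Ξ),
`16·14464(d+1)²(d+4)²·θ ≤ 3` and `2·twoLevelSmall d L·θ ≤ L²` (the class-radius lines of `NE3ClassRadiusFamily.levelSmall_family`).  Proof: choose `εc` from the `θ = 0`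
value of `SmallYLine` (§2, a polynomial in `εc` vanishing at `0`), then `θ` by continuity of every line at `θ = 0` (§1–§2). [folklore] -/
theorem lines_exist {d : ℕ} (hd : 1 ≤ d) {L : ℕ} (hL : 1 ≤ L) {c : ℝ} (hc : 0 ≤ c) :
    ∃ εc θ : ℝ, 0 < εc ∧ 0 < θ ∧ θ ≤ 1 ∧
      ShLine d L c εc θ ≤ 1 / 2 ∧ SmallYLine d L c εc θ ≤ 1 / 2 ∧
      68 / 3 * (((d : ℝ) + 1) * ((d : ℝ) + 4)) * C2sq d L * θ ≤ rho d L / 2 ∧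
      8 * d * (((d : ℝ) - 1) * θ) ^ 2
        + 2 * (c * ((4 * (d : ℝ) ^ 2 + 272 * d * (((d : ℝ) + 1) * ((d : ℝ) + 4))) * θ) ^ 2) ≤ 1 / 2 ∧
      16 * (14464 * ((d : ℝ) + 1) ^ 2 * ((d : ℝ) + 4) ^ 2) * θ ≤ 3 ∧
      2 * twoLevelSmall d L * θ ≤ (L : ℝ) ^ 2 := by
  have _hd := hd
  have _hc := hc
  -- Step 1: `εc` from the `θ = 0` value of `SmallYLine`
  set B : ℝ := bhTop d L c 0 with hB
  have hg : Continuous fun e : ℝ => 2 * (1 + (1 + 8 * e) * 2 * B) * (24 * e + (18 + 1 / 4) * e ^ 2) + 9 * e := by fun_prop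
  have hg0 : Tendsto (fun e : ℝ => 2 * (1 + (1 + 8 * e) * 2 * B) * (24 * e + (18 + 1 / 4) * e ^ 2) + 9 * e) (𝓝 0) (𝓝 0) := by
    have h := hg.tendsto 0
    simpa using h
  have hev : ∀ᶠ e in 𝓝[>] (0 : ℝ),
      2 * (1 + (1 + 8 * e) * 2 * B) * (24 * e + (18 + 1 / 4) * e ^ 2) + 9 * e < 1 / 2 ∧ e ∈ Set.Ioi (0 : ℝ) :=
    ((hg0.eventually_lt_const (by norm_num)).filter_mono nhdsWithin_le_nhds).and eventually_mem_nhdsWithin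
  obtain ⟨εc, hεc_lt, hεc_pos⟩ := hev.exists
  rw [Set.mem_Ioi] at hεc_pos
  -- Step 2: `θ` by continuity of every line at `θ = 0`
  have hL0 : (0 : ℝ) < L := by exact_mod_cast hL
  -- (a) `SmallYLine`
  have ha : ∀ᶠ θ in 𝓝 (0 : ℝ), SmallYLine d L c εc θ < 1 / 2 := by
    have h := (continuous_SmallYLine d L c εc).tendsto 0
    rw [SmallYLine_zero] at h
    exact h.eventually_lt_const hεc_lt
  -- (b) `ShLine`
  have hb : ∀ᶠ θ in 𝓝 (0 : ℝ), ShLine d L c εc θ < 1 / 2 := by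
    have h := (continuous_ShLine d L c εc).tendsto 0
    rw [ShLine_zero] at h
    exact h.eventually_lt_const (by norm_num)
  -- (c) the ℓ²-defect line
  have hc' : ∀ᶠ θ in 𝓝 (0 : ℝ), 68 / 3 * (((d : ℝ) + 1) * ((d : ℝ) + 4)) * C2sq d L * θ < rho d L / 2 := by
    have h : Continuous fun θ : ℝ => 68 / 3 * (((d : ℝ) + 1) * ((d : ℝ) + 4)) * C2sq d L * θ := by fun_prop
    have h' := h.tendsto 0
    simp only [mul_zero] at h'
    exact h'.eventually_lt_const (by linarith [rho_pos d hL])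
  -- (d) K6-Ξ
  have hd' : ∀ᶠ θ in 𝓝 (0 : ℝ), 8 * d * (((d : ℝ) - 1) * θ) ^ 2
      + 2 * (c * ((4 * (d : ℝ) ^ 2 + 272 * d * (((d : ℝ) + 1) * ((d : ℝ) + 4))) * θ) ^ 2) < 1 / 2 := by
    have h : Continuous fun θ : ℝ => 8 * d * (((d : ℝ) - 1) * θ) ^ 2
        + 2 * (c * ((4 * (d : ℝ) ^ 2 + 272 * d * (((d : ℝ) + 1) * ((d : ℝ) + 4))) * θ) ^ 2) := by fun_prop
    have h' := h.tendsto 0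
    simp only [mul_zero, ne_eq, OfNat.ofNat_ne_zero, not_false_eq_true, zero_pow, add_zero] at h'
    exact h'.eventually_lt_const (by norm_num)
  -- (e) the first class-radius line
  have he : ∀ᶠ θ in 𝓝 (0 : ℝ), 16 * (14464 * ((d : ℝ) + 1) ^ 2 * ((d : ℝ) + 4) ^ 2) * θ < 3 := by
    have h : Continuous fun θ : ℝ => 16 * (14464 * ((d : ℝ) + 1) ^ 2 * ((d : ℝ) + 4) ^ 2) * θ := by fun_prop
    have h' := h.tendsto 0
    simp only [mul_zero] at h'
    exact h'.eventually_lt_const (by norm_num)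
  -- (f) the second class-radius line
  have hf : ∀ᶠ θ in 𝓝 (0 : ℝ), 2 * twoLevelSmall d L * θ < (L : ℝ) ^ 2 := by
    have h : Continuous fun θ : ℝ => 2 * twoLevelSmall d L * θ := by fun_prop
    have h' := h.tendsto 0
    simp only [mul_zero] at h'
    exact h'.eventually_lt_const (by positivity)
  -- (g) `θ < 1`
  have hg1 : ∀ᶠ θ in 𝓝 (0 : ℝ), θ < 1 := eventually_lt_nhds (by norm_num)
  have hall := ((((((ha.and hb).and hc').and hd').and he).and hf).and hg1).filter_mono (nhdsWithin_le_nhds (s := Set.Ioi (0 : ℝ)))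
  obtain ⟨θ, ⟨⟨⟨⟨⟨⟨h1, h2⟩, h3⟩, h4⟩, h5⟩, h6⟩, h7⟩, hθpos⟩ := (hall.and eventually_mem_nhdsWithin).exists
  rw [Set.mem_Ioi] at hθpos
  exact ⟨εc, θ, hεc_pos, hθpos, h7.le, h2.le, h1.le, h3.le, h4.le, h5.le, h6.le⟩

/-! ## §4 (P♮)_W on the small-field class for every unitary gauge group, every block size, every dimension `d ≥ 3` -/

variable {n : Type*} [Fintype n] [DecidableEq n]

/-- **(P♮)_W ON THE WHOLE SMALL-FIELD CLASS — ANY `U(n)`, ANY `L ≥ 2`, ANY `d ≥ 3`, ONE CONSTANT.**  There are `εc > 0` and a class radius `0 < θ ≤ 1` (depending on `d, L, card n`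
only; exported together with the K6-Ξ line, the two class-radius lines and `0 ≤ CPLine`, which the energy-slice transfer consumes) such that for every `N ≥ 1`, every `0 < ε ≤ θ`, every
level `j+1` and every `W ∈ sfClass d L N ε (j+1)`:
`SlicePoincare L (j+1) W (frameFreeBlockLandauW L N (j+1) W) (CPLine d L (card n) εc θ) (periodBox (N·L^{j+1}))` — row NE3-R2's `classSlicePoincare_of_lines'` at the point of
`lines_exist`. [folklore] -/
theorem classSlicePoincare_generic [Nonempty n] {d : ℕ} (hd : 3 ≤ d) {L : ℕ} (hL : 2 ≤ L) :
    ∃ εc θ : ℝ, 0 < εc ∧ 0 < θ ∧ θ ≤ 1 ∧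
      8 * d * (((d : ℝ) - 1) * θ) ^ 2
        + 2 * ((Fintype.card n : ℝ) * ((4 * (d : ℝ) ^ 2 + 272 * d * (((d : ℝ) + 1) * ((d : ℝ) + 4))) * θ) ^ 2) ≤ 1 / 2 ∧
      16 * (14464 * ((d : ℝ) + 1) ^ 2 * ((d : ℝ) + 4) ^ 2) * θ ≤ 3 ∧
      2 * twoLevelSmall d L * θ ≤ (L : ℝ) ^ 2 ∧
      0 ≤ CPLine d L (Fintype.card n) εc θ ∧
      ∀ {N : ℕ}, 1 ≤ N → ∀ {ε : ℝ}, 0 < ε → ε ≤ θ →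
        ∀ j : ℕ, ∀ W : Site d → Fin d → (Matrix n n ℂ)ˣ, W ∈ sfClass d L N ε (j + 1) →
          SlicePoincare L (j + 1) W (frameFreeBlockLandauW L N (j + 1) W) (CPLine d L (Fintype.card n) εc θ)
            (periodBox (N * L ^ (j + 1))) := by
  have hd1 : 1 ≤ d := by omega
  have hL1 : 1 ≤ L := by omega
  have hc : (0 : ℝ) ≤ (Fintype.card n : ℝ) := Nat.cast_nonneg _
  obtain ⟨εc, θ, hεc, hθ, hθ1, h1, h2, h3, h4, h5, h6⟩ := lines_exist hd1 hL1 hc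
  refine ⟨εc, θ, hεc, hθ, hθ1, h4, h5, h6, CPLine_nonneg hd1 hc hεc.le hθ.le, ?_⟩
  intro N hN ε hε hεθ j W hW
  have hc₁ : (0 : ℝ) ≤ 16 * (14464 * ((d : ℝ) + 1) ^ 2 * ((d : ℝ) + 4) ^ 2) := by positivity
  have ht : (0 : ℝ) ≤ 2 * twoLevelSmall d L := by unfold twoLevelSmall; positivity
  have hε1 : 16 * (14464 * ((d : ℝ) + 1) ^ 2 * ((d : ℝ) + 4) ^ 2) * ε ≤ 3 :=
    (mul_le_mul_of_nonneg_left hεθ hc₁).trans h5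
  have hε2 : 2 * twoLevelSmall d L * ε ≤ (L : ℝ) ^ 2 := (mul_le_mul_of_nonneg_left hεθ ht).trans h6
  exact classSlicePoincare_of_lines' hd hL hN hε hεθ hεc hε1 hε2 h1 h2 h3 h4 j W hW

end

end Summit.QuantumFields.BalabanUV.T4Continuum.NE7ClassPoincareLinesGeneric
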